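import Mathlib
import Literature.AlgebraicGeometry.Resolution.AffineBlowupIntegral
import Summits.ResolutionOfSingularities.ResolutionOfSingularities.Theorems.WildQuotientsWildQuotientResolutionJordanFourI6Stable

/-!
# V4U-1: `I₆` is `⟨J₄⟩`-stable; the `hρ` of `IsBlowup.liftAction`; `Bl_{I₆} 𝔸ⁿ` integral, proper, birational

(crux stmt-ResolutionOfSingularities-15640 `WildQuotients.WildQuotientResolution`, line `Sketch`,
sector `|G| = p`; programme V4U of `L/w45c/CHAIN.md` v5, plan-1 RULING v5.1 (5): `JordanFour.smul_I6_eq`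
+ `I6_blowup_integral_proper_birational`. [OURS · L1 W4.5c] — NOT a statement of any manuscript;
replaces the role of no printed item. Prover res-L1-w45c-stub-4.)

For the `J₄` datum `σ x_a = x_a`, `σ x_b = x_b + x_a`, `σ x_c = x_c + x_b` (the fourth coordinate and the
passengers do not enter `I₆`): `σ(I₆) = I₆` (`map_I6_le` of `…JordanFourI6Stable` for `σ` and for
`σ⁻¹ : x_b ↦ x_b − x_a, x_c ↦ x_c − x_b + x_a`), `g • I₆ = I₆` for `g ∈ ⟨σ⟩`, the ideal sheaf of `I₆`
is `ρ`-stable for every action with the affine-quotient law (pattern `JordanThree.idealSheaf_k3_comap`,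
p482025), and the blow-up of `𝔸ⁿ` along `I₆` is integral and proper birational (`I₆ ∋ x_a² ≠ 0`).
VECTOR OF RECORD `![X a ^ 2, X a * X b ^ 2, X a * X b * X c, X a * X c ^ 3, X b ^ 3, X b ^ 2 * X c ^ 2,
X b * X c ^ 4, X c ^ 6]`.
-/

-- single-problem summit: the doubled namespace component `ResolutionOfSingularities` is forced
set_option linter.dupNamespace false

noncomputable section

open CategoryTheory AlgebraicGeometry MvPolynomial
open scoped Pointwise
open Literature.AlgebraicGeometry.Resolution

namespace Summit.ResolutionOfSingularities.ResolutionOfSingularities.Theorems.WildQuotientResolution.JordanFour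

/-- **`σ(I₆) = I₆`** for the `J₄` datum (`map_I6_le` for `σ` with `(s,t,u) = (1,1,0)` and for `σ⁻¹`
with `(s,t,u) = (−1,−1,1)`). [folklore] -/
theorem map_I6_eq (k : Type) [Field k] (n : ℕ)
    (σ : MvPolynomial (Fin n) k ≃ₐ[k] MvPolynomial (Fin n) k) (a b c : Fin n)
    (ha : σ (X a) = X a) (hb : σ (X b) = X b + X a) (hc : σ (X c) = X c + X b) :
    Ideal.map (σ : MvPolynomial (Fin n) k →+* MvPolynomial (Fin n) k) (Ideal.span (Set.range
      (![X a ^ 2, X a * X b ^ 2, X a * X b * X c, X a * X c ^ 3, X b ^ 3, X b ^ 2 * X c ^ 2,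
        X b * X c ^ 4, X c ^ 6] : Fin 8 → MvPolynomial (Fin n) k))) =
      Ideal.span (Set.range
        (![X a ^ 2, X a * X b ^ 2, X a * X b * X c, X a * X c ^ 3, X b ^ 3, X b ^ 2 * X c ^ 2,
          X b * X c ^ 4, X c ^ 6] : Fin 8 → MvPolynomial (Fin n) k)) := by
  apply le_antisymm
  · exact map_I6_le k n a b c (σ : MvPolynomial (Fin n) k →+* MvPolynomial (Fin n) k) 1 1 0
      (by simpa only [RingHom.coe_coe] using ha)
      (by simpa only [RingHom.coe_coe, one_mul] using hb)
      (by
        simp only [RingHom.coe_coe, one_mul, zero_mul, add_zero]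
        exact hc)
  · have ha' : σ.symm (X a) = X a := by
      conv_lhs => rw [← ha]
      exact σ.symm_apply_apply _
    have hb' : σ.symm (X b) = X b + (-1) * X a := by
      have h := σ.symm_apply_apply (X b)
      rw [hb, map_add, ha'] at h
      linear_combination h
    have hc' : σ.symm (X c) = X c + (-1) * X b + 1 * X a := by
      have h := σ.symm_apply_apply (X c)
      rw [hc, map_add, hb'] at h
      linear_combination h
    have hle := map_I6_le k n a b c (σ.symm : MvPolynomial (Fin n) k →+* MvPolynomial (Fin n) k)
      (-1) (-1) 1 (by simpa only [RingHom.coe_coe] using ha')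
      (by simpa only [RingHom.coe_coe] using hb') (by simpa only [RingHom.coe_coe] using hc')
    have hcomp : (σ : MvPolynomial (Fin n) k →+* MvPolynomial (Fin n) k).comp
        (σ.symm : MvPolynomial (Fin n) k →+* MvPolynomial (Fin n) k) = RingHom.id _ := by
      ext x <;> simp
    calc Ideal.span (Set.range
          (![X a ^ 2, X a * X b ^ 2, X a * X b * X c, X a * X c ^ 3, X b ^ 3, X b ^ 2 * X c ^ 2,
            X b * X c ^ 4, X c ^ 6] : Fin 8 → MvPolynomial (Fin n) k))
        = Ideal.map ((σ : MvPolynomial (Fin n) k →+* MvPolynomial (Fin n) k).comp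
            (σ.symm : MvPolynomial (Fin n) k →+* MvPolynomial (Fin n) k)) (Ideal.span (Set.range
          (![X a ^ 2, X a * X b ^ 2, X a * X b * X c, X a * X c ^ 3, X b ^ 3, X b ^ 2 * X c ^ 2,
            X b * X c ^ 4, X c ^ 6] : Fin 8 → MvPolynomial (Fin n) k))) := by
          rw [hcomp, Ideal.map_id]
      _ = Ideal.map (σ : MvPolynomial (Fin n) k →+* MvPolynomial (Fin n) k)
            (Ideal.map (σ.symm : MvPolynomial (Fin n) k →+* MvPolynomial (Fin n) k)
              (Ideal.span (Set.range
                (![X a ^ 2, X a * X b ^ 2, X a * X b * X c, X a * X c ^ 3, X b ^ 3,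
                  X b ^ 2 * X c ^ 2, X b * X c ^ 4, X c ^ 6] : Fin 8 → MvPolynomial (Fin n) k)))) := by
          rw [Ideal.map_map]
      _ ≤ _ := Ideal.map_mono hle

/-- **`I₆` is `⟨σ⟩`-stable**: `g • I₆ = I₆` for every `g ∈ ⟨σ⟩`, `J₄` datum — the hypothesis of
`AffineQuotient.idealSheaf_comap_specAction` / `IsBlowup.liftAction` for the one-blow-up first floor
of V4U. [folklore] -/
theorem smul_I6_eq (k : Type) [Field k] (n : ℕ)
    (σ : MvPolynomial (Fin n) k ≃ₐ[k] MvPolynomial (Fin n) k) (a b c : Fin n)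
    (ha : σ (X a) = X a) (hb : σ (X b) = X b + X a) (hc : σ (X c) = X c + X b)
    (g : Subgroup.zpowers σ) :
    g • Ideal.span (Set.range
      (![X a ^ 2, X a * X b ^ 2, X a * X b * X c, X a * X c ^ 3, X b ^ 3, X b ^ 2 * X c ^ 2,
        X b * X c ^ 4, X c ^ 6] : Fin 8 → MvPolynomial (Fin n) k)) =
      Ideal.span (Set.range
        (![X a ^ 2, X a * X b ^ 2, X a * X b * X c, X a * X c ^ 3, X b ^ 3, X b ^ 2 * X c ^ 2,
          X b * X c ^ 4, X c ^ 6] : Fin 8 → MvPolynomial (Fin n) k)) := by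
  have hσ' : σ • Ideal.span (Set.range
      (![X a ^ 2, X a * X b ^ 2, X a * X b * X c, X a * X c ^ 3, X b ^ 3, X b ^ 2 * X c ^ 2,
        X b * X c ^ 4, X c ^ 6] : Fin 8 → MvPolynomial (Fin n) k)) =
      Ideal.span (Set.range
        (![X a ^ 2, X a * X b ^ 2, X a * X b * X c, X a * X c ^ 3, X b ^ 3, X b ^ 2 * X c ^ 2,
          X b * X c ^ 4, X c ^ 6] : Fin 8 → MvPolynomial (Fin n) k)) :=
    map_I6_eq k n σ a b c ha hb hc
  obtain ⟨z, hz⟩ := Subgroup.mem_zpowers_iff.mp g.2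
  change (g : MvPolynomial (Fin n) k ≃ₐ[k] MvPolynomial (Fin n) k) • Ideal.span (Set.range
      (![X a ^ 2, X a * X b ^ 2, X a * X b * X c, X a * X c ^ 3, X b ^ 3, X b ^ 2 * X c ^ 2,
        X b * X c ^ 4, X c ^ 6] : Fin 8 → MvPolynomial (Fin n) k)) = _
  rw [← hz]
  exact MulAction.fixedBy_subset_fixedBy_zpow (Ideal (MvPolynomial (Fin n) k)) σ z hσ'

/-- **The ideal sheaf of `I₆` on `𝔸ⁿ` is stable under every action of `⟨σ⟩` with the affine-quotient law
`ρ g = Spec (g⁻¹)`** — VERBATIM the hypothesis `hρ` of `IsBlowup.liftAction` for `Bl_{I₆} 𝔸ⁿ` (pattern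
`JordanThree.idealSheaf_k3_comap`, p482025). [folklore] -/
theorem idealSheaf_I6_comap (k : Type) [Field k] (n : ℕ)
    (σ : MvPolynomial (Fin n) k ≃ₐ[k] MvPolynomial (Fin n) k) (a b c : Fin n)
    (ha : σ (X a) = X a) (hb : σ (X b) = X b + X a) (hc : σ (X c) = X c + X b)
    (ρ : ↥(Subgroup.zpowers σ) →* Aut (Spec (CommRingCat.of (MvPolynomial (Fin n) k))))
    (hρ : ∀ g : ↥(Subgroup.zpowers σ), (ρ g).hom = Spec.map (CommRingCat.ofHom
      ((MulSemiringAction.toRingEquiv (↥(Subgroup.zpowers σ)) (MvPolynomial (Fin n) k) g⁻¹ :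
        MvPolynomial (Fin n) k ≃+* MvPolynomial (Fin n) k) :
          MvPolynomial (Fin n) k →+* MvPolynomial (Fin n) k)))
    (g : ↥(Subgroup.zpowers σ)) :
    (affineBlowup.idealSheaf (Ideal.span (Set.range
      (![X a ^ 2, X a * X b ^ 2, X a * X b * X c, X a * X c ^ 3, X b ^ 3, X b ^ 2 * X c ^ 2,
        X b * X c ^ 4, X c ^ 6] : Fin 8 → MvPolynomial (Fin n) k)))).comap (ρ g).hom =
      affineBlowup.idealSheaf (Ideal.span (Set.range
        (![X a ^ 2, X a * X b ^ 2, X a * X b * X c, X a * X c ^ 3, X b ^ 3, X b ^ 2 * X c ^ 2,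
          X b * X c ^ 4, X c ^ 6] : Fin 8 → MvPolynomial (Fin n) k))) :=
  AffineQuotient.idealSheaf_comap_specAction ρ hρ _ (smul_I6_eq k n σ a b c ha hb hc) g

/-- **`Bl_{I₆} 𝔸ⁿ` is integral, and proper and birational over `𝔸ⁿ`** (`I₆ ∋ x_a² ≠ 0`; pattern
`ToricExit.centre_blowup_integral_proper_birational`, p485686). [OURS · L1 W4.5c] -/
theorem I6_blowup_integral_proper_birational (k : Type) [Field k] (n : ℕ) (a b c : Fin n) :
    IsIntegral (affineBlowup (Ideal.span (Set.range
        (![X a ^ 2, X a * X b ^ 2, X a * X b * X c, X a * X c ^ 3, X b ^ 3, X b ^ 2 * X c ^ 2,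
          X b * X c ^ 4, X c ^ 6] : Fin 8 → MvPolynomial (Fin n) k)))) ∧
      IsProper (affineBlowup.π (Ideal.span (Set.range
        (![X a ^ 2, X a * X b ^ 2, X a * X b * X c, X a * X c ^ 3, X b ^ 3, X b ^ 2 * X c ^ 2,
          X b * X c ^ 4, X c ^ 6] : Fin 8 → MvPolynomial (Fin n) k)))) ∧
      IsBirational (affineBlowup.π (Ideal.span (Set.range
        (![X a ^ 2, X a * X b ^ 2, X a * X b * X c, X a * X c ^ 3, X b ^ 3, X b ^ 2 * X c ^ 2,
          X b * X c ^ 4, X c ^ 6] : Fin 8 → MvPolynomial (Fin n) k)))) := by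
  have hne : Ideal.span (Set.range
      (![X a ^ 2, X a * X b ^ 2, X a * X b * X c, X a * X c ^ 3, X b ^ 3, X b ^ 2 * X c ^ 2,
        X b * X c ^ 4, X c ^ 6] : Fin 8 → MvPolynomial (Fin n) k)) ≠ ⊥ := by
    intro h
    rw [Ideal.span_eq_bot] at h
    exact pow_ne_zero 2 (X_ne_zero a) (h _ ⟨0, rfl⟩)
  exact ⟨affineBlowup.isIntegral hne, inferInstance, affineBlowup.isBirational hne⟩

end Summit.ResolutionOfSingularities.ResolutionOfSingularities.Theorems.WildQuotientResolution.JordanFour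

end
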